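import Literature.MathematicalPhysics.QuantumFieldTheory.Balaban1983to89.B9Ineq346GpFlatMultiLevelTorus

/-!
# `Balaban1983to89.B9Ineq346SecondOrderTorusCore` — [B9] (3.46) AT `U = 1`, THE SECOND-ORDER MEMBERS: the torus-level
ANALYTIC CORE (local energy identities on the discrete torus `Π_μ ℤ/N_μ`) by which the three `L²` members
`‖h∇G′∇*λ‖, ‖h∇∇G′λ‖, ‖hG′∇*∇*λ‖` of Theorem 3.1 for the scalar propagator `G′ = Δ′_a⁻¹` at `U = 1` are reduced to the
members `‖hG′λ‖, ‖h∇G′λ‖, ‖hG′∇*λ‖` PROVED by lit-balaban-p21 (`B9Ineq346GpFlatMultiLevelTorus`)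

T. Bałaban, *Propagators for lattice gauge theories in a background field*, Commun. Math. Phys. **99** (1985) 389–434
[`Balaban1985BackgroundPropagators`, "B9"]; [4] = T. Bałaban, *Propagators and renormalization transformations for lattice
gauge theories. II*, Commun. Math. Phys. **96** (1984) 223–250 [`Balaban1984PropagatorsII`].

statement-level skeleton of published theorems with citation tags; proofs where landed; nothing here is a claim about the
Yang–Mills mass gap

THE PRINTED LOCI (verbatim).  (3.46), p. 398: *"Finally, we have the inequalities in L²-norms ‖hG′(U)λ‖, ‖h∇_UG′(U)λ‖,
‖hG′(U)∇\*_Uλ‖, ‖h∇_UG′(U)∇\*_Uλ‖, ‖h∇_U∇_UG′(U)λ‖, ‖hG′(U)∇\*_U∇\*_Uλ‖ ≦ B₀[(Lʲη)², Lʲη, Lʲη, 1, 1, 1]|h|e^{−δ₀d(y,y′)}‖λ‖ for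
supp h ⊂ Δ̃(y), y ∈ Λ_j, supp λ ⊂ Δ(y′)"*; Cor. 3.5, p. 407: *"For operators with the external gauge field configuration U = 1,
these theorems are proved in [4]"* — but [4] prints at U = 1 only the sup ∕ Hölder members (2.67) (cell GAP G-B9-03a), and
the second-order members have NO sup majorant there (Schur's test, by which p21 derived the members 0, 1, 2, does not apply).

THE POINT.  On the torus of the lineage (`B6MultiLevelTorusOperator`: sites `Π_μ[0, N_μ)`, translations `tshift`, the
periodic Laplacian `−Δ = perLapT N = Σ_μ ∂_μᵀ∂_μ` with `∂_μ = dT N μ = S_{e_μ} − 1`) the second-order members follow from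
the first-order ones by three ELEMENTARY local identities, certified here once and for all (pure algebra, no operator
`Δ′_a` yet except in §5):

* §1 shift algebra: `shiftMat_mul`, `shiftMat_zero`, `shiftMat_comm`, `dT_transpose`, `dT_comm`, `dT_transpose_comm`,
  `dT_transpose_mul_dT`, `perLapT_eq_sum_dT` (`−Δ = Σ_μ ∂_μᵀ∂_μ`).
* §2 ★ THE TORUS H² IDENTITY `sq_dT_dT_le_sq_perLapT`: `Σ_x ((∂_μ∂_νv)(x))² ≤ Σ_x ((−Δv)(x))²` for EVERY `v` (all shifts
  commute: `Σ_{μν}‖∂_μ∂_νv‖² = ‖Δv‖²`).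
* §3 the product rule `perLapT_mulVec_mul`: `−Δ(χu) = χ·(−Δu) + u·(−Δχ) − B(χ,u)`,
  `B(χ,u)(x) = Σ_{±μ}(χ(x±e_μ) − χ(x))(u(x±e_μ) − u(x))` (written out; no definition is introduced), and its square bounds `commB_sq_le`, `sum_commB_sq_le`.
* §4 ★ THE DISCRETE CACCIOPPOLI INEQUALITY `caccioppoli_torus`:
  `Σ_μΣ_x χ(x+e_μ)²(u(x+e_μ) − u(x))² ≤ 2⟨χ²u, −Δu⟩ + 8Σ_μΣ_x(χ(x+e_μ) − χ(x))²(u(x)² + u(x+e_μ)²)` (the bilinear form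
  `perLapT_bilin`: `⟨f, −Δg⟩ = Σ_μΣ_x ∂_μf·∂_μg`).
* §5 the averaging part `V = Δ′_a − (−Δ)` of the genuine k-level torus operator `mlOpT` of a `TDomains` family: it is
  `levC_{j(x)}·Σ_{B(x)} u` (`mlOpT_mulVec_eq`), hence `|⟨φ, Vu⟩| ≤ Σ_s a_{j(s)}L^{−2j(s)}·max|φ∕u-ratio|…` in the two forms
  used downstream: `abs_form_V_le` (`|⟨χ²u, Vu⟩| ≤ Σ_{s∈𝒩} a_{j(s)}L^{−2j(s)}Σ_{x∈B(s)}u(x)²` for `0 ≤ χ ≤ 1` supported over `𝒩`)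
  and `sum_sq_V_le` (`Σ_x χ(x)²((Vu)(x))² ≤ Σ_{s∈𝒩}(a_{j(s)}L^{−2j(s)})²Σ_{x∈B(s)}u(x)²`); the localisation lemma `sum_weight_le`.
* §6 ★ DUALITY `transpose_block_bound`: a block bound `Σ_{x∈B′}((Th)(x))² ≤ K·Σh²` for all `h` supported in `B` IS the block
  bound `Σ_{x∈B}((Tᵀλ)(x))² ≤ K·Σλ²` for all `λ` supported in `B′` — by which the member `G′∇*∇* = (∇∇G′)ᵀ` costs nothing.

HONEST SCOPE.  Finite-dimensional identities ∕ inequalities on the discrete torus, kernel-checked; no inequality of [B9] or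
[4] is asserted here; the members themselves are assembled in the sequel files (`…SecondOrderTorusCutoff`,
`…SecondOrderFlatMultiLevelTorus`, `…SecondOrderGpAtLetters`).  One finite lattice programme — nothing continuum, nothing
about the mass gap.  Cell `pub-ymgap` (HUMAN RULING D-0062), Track A node N06 [B9], N06-ASSIGNMENT v1 row 11 (bundle F3) at
def-Y's instance, seat `pub-ymgap-dag-n06-h` (g3), 2026-08-27.
-/

noncomputable section

namespace Literature.MathematicalPhysics.QuantumFieldTheory.Balaban1983to89.B9Ineq346SecondOrderTorusCore

open Finset Matrix
open B4Reflection242 (boxDom avgK)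
open B6MultiLevelBoxOperator (N0 levC)
open B6MultiLevelTorusOperator
open B6Prop22DerivMultiLevelTorus (dT dT_mulVec)
open B6Geom246MultiLevelBox (bset blkOf)
open B6Ineq268MultiLevelBox (W W_eq card_blkOf_le)
open B9Thm314GpFlatTorusGeometry (avgK_lev_eq)

variable {d : ℕ}

/-! ## §1 Shift algebra on the torus -/

section Shift

variable (N : Fin (d + 1) → ℕ)

/-- `S_u·S_v = S_{u+v}` (translations compose). [cite: Balaban1983RegularityDecay, p.572 («a torus T_η … with periodic conditions»), dictionary] -/
theorem shiftMat_mul (u v : Fin (d + 1) → ℤ) : shiftMat N u * shiftMat N v = shiftMat N (u + v) := by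
  classical
  ext x z
  simp only [Matrix.mul_apply, shiftMat]
  rw [Finset.sum_eq_single (tshift N u x)]
  · rw [if_pos rfl, one_mul, tshift_tshift]
  · intro y _ hy; rw [if_neg hy, zero_mul]
  · intro h; exact absurd (Finset.mem_univ _) h

/-- `S_0 = 1`. [cite: Balaban1983RegularityDecay, p.572 («a torus T_η … with periodic conditions»), dictionary] -/
theorem shiftMat_zero : shiftMat N (0 : Fin (d + 1) → ℤ) = 1 := by
  classical
  ext x z
  simp only [shiftMat, tshift_zero, Matrix.one_apply]
  by_cases h : z = x
  · rw [if_pos h, if_pos h.symm]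
  · rw [if_neg h, if_neg (Ne.symm h)]

/-- translations commute: `S_u·S_v = S_v·S_u`. [cite: Balaban1983RegularityDecay, p.572 («a torus T_η … with periodic conditions»), dictionary] -/
theorem shiftMat_comm (u v : Fin (d + 1) → ℤ) : shiftMat N u * shiftMat N v = shiftMat N v * shiftMat N u := by
  rw [shiftMat_mul, shiftMat_mul, add_comm u v]

/-- `∂_μᵀ = S_{−e_μ} − 1` (the backward difference, up to sign). [cite: Balaban1984PropagatorsII, (2.67) p.234 (the entry G′∇^{η*}), dictionary] -/
theorem dT_transpose (μ : Fin (d + 1)) : (dT N μ)ᵀ = shiftMat N (-unitVec μ) - 1 := by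
  unfold dT
  rw [Matrix.transpose_sub, Matrix.transpose_one, ← shiftMat_neg]

/-- `(∂_μᵀf)(x) = f(x − e_μ) − f(x)`. [cite: Balaban1984PropagatorsII, (2.67) p.234, dictionary] -/
theorem dT_transpose_mulVec (μ : Fin (d + 1)) (f : ↥(boxDom N) → ℝ) (x : ↥(boxDom N)) :
    ((dT N μ)ᵀ *ᵥ f) x = f (tshift N (-unitVec μ) x) - f x := by
  rw [dT_transpose, Matrix.sub_mulVec, Pi.sub_apply, shiftMat_mulVec, Matrix.one_mulVec]

/-- forward differences commute: `∂_μ∂_ν = ∂_ν∂_μ`. [cite: Balaban1984PropagatorsII, (2.67) p.234, dictionary] -/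
theorem dT_comm (μ ν : Fin (d + 1)) : dT N μ * dT N ν = dT N ν * dT N μ := by
  unfold dT
  simp only [Matrix.sub_mul, Matrix.mul_sub, Matrix.one_mul, Matrix.mul_one, shiftMat_comm N (unitVec μ) (unitVec ν)]
  abel

/-- `∂_μᵀ∂_ν = ∂_ν∂_μᵀ`. [cite: Balaban1984PropagatorsII, (2.67) p.234, dictionary] -/
theorem dT_transpose_comm (μ ν : Fin (d + 1)) : (dT N μ)ᵀ * dT N ν = dT N ν * (dT N μ)ᵀ := by
  rw [dT_transpose]
  unfold dT
  simp only [Matrix.sub_mul, Matrix.mul_sub, Matrix.one_mul, Matrix.mul_one, shiftMat_comm N (-unitVec μ) (unitVec ν)]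
  abel

/-- `∂_μᵀ∂_νᵀ = ∂_νᵀ∂_μᵀ`. [cite: Balaban1984PropagatorsII, (2.67) p.234, dictionary] -/
theorem dT_transpose_comm' (μ ν : Fin (d + 1)) : (dT N μ)ᵀ * (dT N ν)ᵀ = (dT N ν)ᵀ * (dT N μ)ᵀ := by
  rw [← Matrix.transpose_mul, ← Matrix.transpose_mul, dT_comm]

/-- `∂_μᵀ∂_μ = 2 − S_{e_μ} − S_{−e_μ}` (one summand of the periodic Laplacian). [cite: Balaban1983RegularityDecay, (1.3) p.572, dictionary] -/
theorem dT_transpose_mul_dT (μ : Fin (d + 1)) :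
    (dT N μ)ᵀ * dT N μ = (2 : ℝ) • (1 : Matrix ↥(boxDom N) ↥(boxDom N) ℝ) - shiftMat N (unitVec μ) - shiftMat N (-unitVec μ) := by
  rw [dT_transpose]
  unfold dT
  rw [Matrix.sub_mul, Matrix.mul_sub, Matrix.mul_sub, Matrix.one_mul, Matrix.mul_one, Matrix.one_mul, shiftMat_mul,
    neg_add_cancel, shiftMat_zero, two_smul]
  abel

/-- **`−Δ = Σ_μ ∂_μᵀ∂_μ`** on the torus. [cite: Balaban1983RegularityDecay, (1.3) p.572 with «periodic conditions», dictionary] -/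
theorem perLapT_eq_sum_dT : perLapT N = ∑ μ : Fin (d + 1), (dT N μ)ᵀ * dT N μ := by
  unfold perLapT
  exact Finset.sum_congr rfl fun μ _ => (dT_transpose_mul_dT N μ).symm

end Shift

/-! ## §2 The torus H² identity -/

section H2

variable (N : Fin (d + 1) → ℕ)

/-- `‖Av‖² = ⟨v, AᵀA v⟩`. [cite: Balaban1985BackgroundPropagators, (3.46) p.398, dictionary (L² bookkeeping)] -/
theorem mulVec_dot_self {X : Type} [Fintype X] (A : Matrix X X ℝ) (v : X → ℝ) :
    (A *ᵥ v) ⬝ᵥ (A *ᵥ v) = v ⬝ᵥ ((Aᵀ * A) *ᵥ v) := by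
  rw [← Matrix.mulVec_mulVec, Matrix.dotProduct_mulVec v Aᵀ (A *ᵥ v), Matrix.vecMul_transpose]

/-- `Σ_x (Av)(x)² = ⟨v, AᵀA v⟩`. [cite: Balaban1985BackgroundPropagators, (3.46) p.398, dictionary (L² bookkeeping)] -/
theorem sum_sq_mulVec_eq {X : Type} [Fintype X] (A : Matrix X X ℝ) (v : X → ℝ) :
    ∑ x, ((A *ᵥ v) x) ^ 2 = v ⬝ᵥ ((Aᵀ * A) *ᵥ v) := by
  rw [← mulVec_dot_self]
  unfold dotProduct
  exact Finset.sum_congr rfl fun x _ => by ring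

/-- `∂_μᵀ∂_μ` commutes with `∂_ν` and `∂_νᵀ`, hence with `∂_νᵀ∂_ν`. [cite: Balaban1984PropagatorsII, (2.67) p.234, dictionary] -/
theorem commute_P_dT (μ ν : Fin (d + 1)) : Commute ((dT N μ)ᵀ * dT N μ) (dT N ν) :=
  Commute.mul_left (dT_transpose_comm N μ ν) (dT_comm N μ ν)

/-- `∂_μᵀ∂_μ` commutes with `∂_νᵀ`. [cite: Balaban1984PropagatorsII, (2.67) p.234, dictionary] -/
theorem commute_P_dT_transpose (μ ν : Fin (d + 1)) : Commute ((dT N μ)ᵀ * dT N μ) (dT N ν)ᵀ :=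
  Commute.mul_left (dT_transpose_comm' N μ ν) (Commute.symm (dT_transpose_comm N ν μ))

/-- `∂_μᵀ∂_μ` and `∂_νᵀ∂_ν` commute. [cite: Balaban1984PropagatorsII, (2.67) p.234, dictionary] -/
theorem commute_P_P (μ ν : Fin (d + 1)) : Commute ((dT N μ)ᵀ * dT N μ) ((dT N ν)ᵀ * dT N ν) :=
  Commute.mul_right (commute_P_dT_transpose N μ ν) (commute_P_dT N μ ν)

/-- `(∂_μ∂_ν)ᵀ(∂_μ∂_ν) = (∂_νᵀ∂_ν)(∂_μᵀ∂_μ)` (all shifts commute). [cite: Balaban1985BackgroundPropagators, (3.46) p.398 (the member ∇∇G′), dictionary] -/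
theorem dT_dT_transpose_mul (μ ν : Fin (d + 1)) :
    (dT N μ * dT N ν)ᵀ * (dT N μ * dT N ν) = ((dT N ν)ᵀ * dT N ν) * ((dT N μ)ᵀ * dT N μ) := by
  rw [Matrix.transpose_mul]
  calc (dT N ν)ᵀ * (dT N μ)ᵀ * (dT N μ * dT N ν) = (dT N ν)ᵀ * (((dT N μ)ᵀ * dT N μ) * dT N ν) := by
        simp only [Matrix.mul_assoc]
    _ = (dT N ν)ᵀ * (dT N ν * ((dT N μ)ᵀ * dT N μ)) := by rw [(commute_P_dT N μ ν).eq]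
    _ = (dT N ν)ᵀ * dT N ν * ((dT N μ)ᵀ * dT N μ) := by simp only [Matrix.mul_assoc]

/-- ★ **THE TORUS H² IDENTITY (one pair of directions)**: `Σ_x((∂_μ∂_νv)(x))² ≤ Σ_x((−Δv)(x))²` for every function `v`
on the torus — `Σ_{μ′ν′}‖∂_{μ′}∂_{ν′}v‖² = ⟨v, (Σ∂ᵀ∂)²v⟩ = ‖Δv‖²` and every term is a square.
[cite: Balaban1985BackgroundPropagators, (3.46) p.398 (the member ∇∇G′ at U = 1), dictionary (discrete elliptic regularity on the torus)] -/
theorem sq_dT_dT_le_sq_perLapT (μ ν : Fin (d + 1)) (v : ↥(boxDom N) → ℝ) :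
    ∑ x, (((dT N μ * dT N ν) *ᵥ v) x) ^ 2 ≤ ∑ x, ((perLapT N *ᵥ v) x) ^ 2 := by
  -- every pair contributes a square
  have hterm : ∀ μ' ν' : Fin (d + 1), ∑ x, (((dT N μ' * dT N ν') *ᵥ v) x) ^ 2
      = v ⬝ᵥ ((((dT N ν')ᵀ * dT N ν') * ((dT N μ')ᵀ * dT N μ')) *ᵥ v) := by
    intro μ' ν'
    rw [sum_sq_mulVec_eq, dT_dT_transpose_mul]
  have hnn : ∀ μ' ν' : Fin (d + 1), 0 ≤ v ⬝ᵥ ((((dT N ν')ᵀ * dT N ν') * ((dT N μ')ᵀ * dT N μ')) *ᵥ v) := by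
    intro μ' ν'; rw [← hterm]; exact Finset.sum_nonneg fun x _ => sq_nonneg _
  -- the double sum is `‖Δv‖²`
  have htot : ∑ μ', ∑ ν', v ⬝ᵥ ((((dT N ν')ᵀ * dT N ν') * ((dT N μ')ᵀ * dT N μ')) *ᵥ v)
      = ∑ x, ((perLapT N *ᵥ v) x) ^ 2 := by
    rw [sum_sq_mulVec_eq, (perLapT_isSymm N).eq, perLapT_eq_sum_dT, Finset.sum_mul]
    simp only [Finset.mul_sum]
    rw [Matrix.sum_mulVec, dotProduct_sum]
    refine Finset.sum_congr rfl fun μ' _ => ?_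
    rw [Matrix.sum_mulVec, dotProduct_sum]
    refine Finset.sum_congr rfl fun ν' _ => ?_
    rw [(commute_P_P N μ' ν').eq]
  rw [hterm, ← htot]
  calc v ⬝ᵥ ((((dT N ν)ᵀ * dT N ν) * ((dT N μ)ᵀ * dT N μ)) *ᵥ v)
      ≤ ∑ ν', v ⬝ᵥ ((((dT N ν')ᵀ * dT N ν') * ((dT N μ)ᵀ * dT N μ)) *ᵥ v) :=
        Finset.single_le_sum (fun ν' _ => hnn μ ν') (Finset.mem_univ ν)
    _ ≤ ∑ μ', ∑ ν', v ⬝ᵥ ((((dT N ν')ᵀ * dT N ν') * ((dT N μ')ᵀ * dT N μ')) *ᵥ v) :=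
        Finset.single_le_sum (fun μ' _ => Finset.sum_nonneg fun ν' _ => hnn μ' ν') (Finset.mem_univ μ)

end H2

/-! ## §3 The product rule for the periodic Laplacian -/

section ProductRule

variable (N : Fin (d + 1) → ℕ)

/-- **THE PRODUCT RULE** `−Δ(χu) = χ·(−Δu) + u·(−Δχ) − B(χ,u)` on the torus.
[cite: Balaban1985BackgroundPropagators, (3.46) p.398, dictionary (discrete Leibniz rule)] -/
theorem perLapT_mulVec_mul (χ u : ↥(boxDom N) → ℝ) (x : ↥(boxDom N)) :
    (perLapT N *ᵥ (fun z => χ z * u z)) x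
      = χ x * (perLapT N *ᵥ u) x + u x * (perLapT N *ᵥ χ) x
        - (∑ μ : Fin (d + 1), ((χ (tshift N (unitVec μ) x) - χ x) * (u (tshift N (unitVec μ) x) - u x)
          + (χ (tshift N (-unitVec μ) x) - χ x) * (u (tshift N (-unitVec μ) x) - u x))) := by
  rw [perLapT_mulVec, perLapT_mulVec, perLapT_mulVec, Finset.mul_sum, Finset.mul_sum, ← Finset.sum_add_distrib,
    ← Finset.sum_sub_distrib]
  exact Finset.sum_congr rfl fun μ _ => by ring

/-- `(Σ_{i<n} c_i)² ≤ n·Σ c_i²` specialised: the square of `B(χ,u)(x)` against the squared bond terms.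
[cite: Balaban1985BackgroundPropagators, (3.46) p.398, dictionary] -/
theorem commB_sq_le (χ u : ↥(boxDom N) → ℝ) (x : ↥(boxDom N)) :
    (∑ μ : Fin (d + 1), ((χ (tshift N (unitVec μ) x) - χ x) * (u (tshift N (unitVec μ) x) - u x)
          + (χ (tshift N (-unitVec μ) x) - χ x) * (u (tshift N (-unitVec μ) x) - u x))) ^ 2 ≤ 2 * ((d : ℝ) + 1) * ∑ μ : Fin (d + 1),
      (((χ (tshift N (unitVec μ) x) - χ x) * (u (tshift N (unitVec μ) x) - u x)) ^ 2
        + ((χ (tshift N (-unitVec μ) x) - χ x) * (u (tshift N (-unitVec μ) x) - u x)) ^ 2) := by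
  have h := sq_sum_le_card_mul_sum_sq (s := (Finset.univ : Finset (Fin (d + 1))))
    (f := fun μ => (χ (tshift N (unitVec μ) x) - χ x) * (u (tshift N (unitVec μ) x) - u x)
      + (χ (tshift N (-unitVec μ) x) - χ x) * (u (tshift N (-unitVec μ) x) - u x))
  rw [Finset.card_univ, Fintype.card_fin] at h
  push_cast at h
  refine h.trans ?_
  rw [mul_assoc, Finset.mul_sum, Finset.mul_sum, Finset.mul_sum]
  refine Finset.sum_le_sum fun μ _ => ?_
  have hd : (0 : ℝ) ≤ (d : ℝ) + 1 := by positivity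
  nlinarith [sq_nonneg ((χ (tshift N (unitVec μ) x) - χ x) * (u (tshift N (unitVec μ) x) - u x)
      - (χ (tshift N (-unitVec μ) x) - χ x) * (u (tshift N (-unitVec μ) x) - u x)), hd]

/-- reindexing a torus sum along `σ_{e_μ}`: the backward bond terms are the forward bond terms.
[cite: Balaban1983RegularityDecay, p.572 («periodic conditions»), dictionary] -/
theorem sum_backward_eq_forward (F : ℝ → ℝ → ℝ → ℝ → ℝ) (χ u : ↥(boxDom N) → ℝ) (μ : Fin (d + 1)) :
    ∑ x, F (χ (tshift N (-unitVec μ) x)) (χ x) (u (tshift N (-unitVec μ) x)) (u x)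
      = ∑ x, F (χ x) (χ (tshift N (unitVec μ) x)) (u x) (u (tshift N (unitVec μ) x)) := by
  rw [← Equiv.sum_comp (tshift N (unitVec μ))
    (fun x => F (χ (tshift N (-unitVec μ) x)) (χ x) (u (tshift N (-unitVec μ) x)) (u x))]
  refine Finset.sum_congr rfl fun x _ => ?_
  rw [tshift_tshift, add_neg_cancel, tshift_zero]

/-- **THE SQUARE BOUND OF THE COMMUTATOR TERM**, summed over the torus, with the bond weights `(χ(x+e_μ) − χ(x))²` kept
INSIDE (they localise and carry the small factor `|∇χ|²`):
`Σ_x B(χ,u)(x)² ≤ 4(d+1)·Σ_μΣ_x (χ(x+e_μ) − χ(x))²(u(x+e_μ) − u(x))²`.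
[cite: Balaban1985BackgroundPropagators, (3.46) p.398, dictionary (discrete Leibniz rule)] -/
theorem sum_commB_sq_le (χ u : ↥(boxDom N) → ℝ) :
    ∑ x, (∑ μ : Fin (d + 1), ((χ (tshift N (unitVec μ) x) - χ x) * (u (tshift N (unitVec μ) x) - u x)
          + (χ (tshift N (-unitVec μ) x) - χ x) * (u (tshift N (-unitVec μ) x) - u x))) ^ 2 ≤ 4 * ((d : ℝ) + 1) * ∑ μ : Fin (d + 1), ∑ x,
      (χ (tshift N (unitVec μ) x) - χ x) ^ 2 * (u (tshift N (unitVec μ) x) - u x) ^ 2 := by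
  calc ∑ x, (∑ μ : Fin (d + 1), ((χ (tshift N (unitVec μ) x) - χ x) * (u (tshift N (unitVec μ) x) - u x)
          + (χ (tshift N (-unitVec μ) x) - χ x) * (u (tshift N (-unitVec μ) x) - u x))) ^ 2
      ≤ ∑ x, 2 * ((d : ℝ) + 1) * ∑ μ : Fin (d + 1),
          (((χ (tshift N (unitVec μ) x) - χ x) * (u (tshift N (unitVec μ) x) - u x)) ^ 2
            + ((χ (tshift N (-unitVec μ) x) - χ x) * (u (tshift N (-unitVec μ) x) - u x)) ^ 2) :=
        Finset.sum_le_sum fun x _ => commB_sq_le N χ u x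
    _ = 2 * ((d : ℝ) + 1) * ∑ μ : Fin (d + 1), ((∑ x,
          ((χ (tshift N (unitVec μ) x) - χ x) * (u (tshift N (unitVec μ) x) - u x)) ^ 2)
          + ∑ x, ((χ (tshift N (-unitVec μ) x) - χ x) * (u (tshift N (-unitVec μ) x) - u x)) ^ 2) := by
        rw [← Finset.mul_sum, Finset.sum_comm]
        simp only [Finset.sum_add_distrib]
    _ = 2 * ((d : ℝ) + 1) * ∑ μ : Fin (d + 1), (2 * ∑ x,
          (χ (tshift N (unitVec μ) x) - χ x) ^ 2 * (u (tshift N (unitVec μ) x) - u x) ^ 2) := by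
        congr 1
        refine Finset.sum_congr rfl fun μ _ => ?_
        rw [sum_backward_eq_forward N (fun a b c e => ((a - b) * (c - e)) ^ 2) χ u μ, two_mul]
        simp only [mul_pow]
        congr 1
        exact Finset.sum_congr rfl fun x _ => by ring
    _ = _ := by rw [← Finset.mul_sum]; ring

end ProductRule

/-! ## §4 The bilinear form of `−Δ` and the discrete Caccioppoli inequality -/

section Caccioppoli

variable (N : Fin (d + 1) → ℕ)

/-- **THE BILINEAR FORM OF `−Δ^{per}`**: `⟨f, −Δg⟩ = Σ_μ Σ_x (f(x+e_μ) − f(x))(g(x+e_μ) − g(x))` (polarisation of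
`perLapT_form`, `−Δ` symmetric). [cite: Balaban1983RegularityDecay, (1.3) p.572, dictionary] -/
theorem perLapT_bilin (f g : ↥(boxDom N) → ℝ) :
    f ⬝ᵥ perLapT N *ᵥ g = ∑ μ, ∑ x, (f (tshift N (unitVec μ) x) - f x) * (g (tshift N (unitVec μ) x) - g x) := by
  -- polarisation: `2⟨f, Lg⟩ = Q(f+g) − Q(f) − Q(g)`
  have hsymm : g ⬝ᵥ perLapT N *ᵥ f = f ⬝ᵥ perLapT N *ᵥ g := by
    rw [Matrix.dotProduct_mulVec, ← Matrix.mulVec_transpose, (perLapT_isSymm N).eq, dotProduct_comm]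
  have hQ : (f + g) ⬝ᵥ perLapT N *ᵥ (f + g) = f ⬝ᵥ perLapT N *ᵥ f + g ⬝ᵥ perLapT N *ᵥ g + 2 * (f ⬝ᵥ perLapT N *ᵥ g) := by
    rw [Matrix.mulVec_add, add_dotProduct, dotProduct_add, dotProduct_add, hsymm]; ring
  have h2 : 2 * (f ⬝ᵥ perLapT N *ᵥ g)
      = 2 * ∑ μ, ∑ x, (f (tshift N (unitVec μ) x) - f x) * (g (tshift N (unitVec μ) x) - g x) := by
    have e := hQ
    rw [perLapT_form, perLapT_form, perLapT_form] at e
    have : ∑ μ, ∑ x, ((f + g) x - (f + g) (tshift N (unitVec μ) x)) ^ 2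
        = (∑ μ, ∑ x, (f x - f (tshift N (unitVec μ) x)) ^ 2) + (∑ μ, ∑ x, (g x - g (tshift N (unitVec μ) x)) ^ 2)
          + 2 * ∑ μ, ∑ x, (f (tshift N (unitVec μ) x) - f x) * (g (tshift N (unitVec μ) x) - g x) := by
      rw [Finset.mul_sum, ← Finset.sum_add_distrib, ← Finset.sum_add_distrib]
      refine Finset.sum_congr rfl fun μ _ => ?_
      rw [Finset.mul_sum, ← Finset.sum_add_distrib, ← Finset.sum_add_distrib]
      refine Finset.sum_congr rfl fun x _ => ?_
      simp only [Pi.add_apply]; ring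
    linarith
  linarith

/-- the pointwise inequality behind Caccioppoli: with `p = χ(x+e)`, `q = χ(x)`, `u′ = u(x+e)`:
`p²(u′−u)² ≤ 2(p²u′ − q²u)(u′ − u) + 8(p − q)²(u² + u′²)` (a sum of squares). [cite: Balaban1985BackgroundPropagators, (3.46) p.398, dictionary (local energy estimate)] -/
theorem caccioppoli_pointwise (p q u u' : ℝ) :
    p ^ 2 * (u' - u) ^ 2 ≤ 2 * ((p ^ 2 * u' - q ^ 2 * u) * (u' - u)) + 8 * ((p - q) ^ 2 * (u ^ 2 + u' ^ 2)) := by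
  nlinarith [sq_nonneg (p * (u' - u) + 2 * (p - q) * u), mul_nonneg (sq_nonneg (p - q)) (sq_nonneg (6 * u - u')),
    mul_nonneg (sq_nonneg (p - q)) (sq_nonneg u'), mul_nonneg (sq_nonneg (p - q)) (sq_nonneg u)]

/-- ★ **THE DISCRETE CACCIOPPOLI INEQUALITY ON THE TORUS**: for all real `χ`, `u`,
`Σ_μΣ_x χ(x+e_μ)²(u(x+e_μ) − u(x))² ≤ 2⟨χ²u, −Δu⟩ + 8Σ_μΣ_x (χ(x+e_μ) − χ(x))²(u(x)² + u(x+e_μ)²)`.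
[cite: Balaban1985BackgroundPropagators, (3.46) p.398 (the member ∇G′∇* at U = 1), dictionary (local energy estimate)] -/
theorem caccioppoli_torus (χ u : ↥(boxDom N) → ℝ) :
    ∑ μ, ∑ x, χ (tshift N (unitVec μ) x) ^ 2 * (u (tshift N (unitVec μ) x) - u x) ^ 2
      ≤ 2 * ((fun z => χ z ^ 2 * u z) ⬝ᵥ perLapT N *ᵥ u)
        + 8 * ∑ μ, ∑ x, (χ (tshift N (unitVec μ) x) - χ x) ^ 2 * (u x ^ 2 + u (tshift N (unitVec μ) x) ^ 2) := by
  rw [perLapT_bilin, Finset.mul_sum, Finset.mul_sum, ← Finset.sum_add_distrib]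
  refine Finset.sum_le_sum fun μ _ => ?_
  rw [Finset.mul_sum, Finset.mul_sum, ← Finset.sum_add_distrib]
  exact Finset.sum_le_sum fun x _ => caccioppoli_pointwise _ _ _ _

end Caccioppoli

/-! ## §5 The averaging part of the genuine `k`-level torus operator -/

section Averaging

variable {ℓ Mh k R : ℕ} {P : Fin (d + 1) → ℕ} (D : TDomains d ℓ Mh k P R) (a : ℕ → ℝ)

/-- **`Δ′_a = −Δ^{per} + V`, `(Vu)(x) = levC_{j(x)}·Σ_{x′ ∈ B(x)} u(x′)`** — the averaging part of the torus operator
applied to a vector. [cite: Balaban1984PropagatorsII, (2.13)–(2.14) p.225] -/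
theorem mlOpT_mulVec_eq (u : ↥(boxDom (N0 ℓ Mh k P)) → ℝ) (x : ↥(boxDom (N0 ℓ Mh k P))) :
    (mlOpT (N0 ℓ Mh k P) ℓ k D.lev a *ᵥ u) x
      = (perLapT (N0 ℓ Mh k P) *ᵥ u) x
        + levC d ℓ a (D.lev x.1) * ∑ y ∈ Finset.univ.filter (fun y => blkOf D.toDomains y = blkOf D.toDomains x), u y := by
  classical
  have happ : ∀ y, mlOpT (N0 ℓ Mh k P) ℓ k D.lev a x y * u y
      = perLapT (N0 ℓ Mh k P) x y * u y + avgK (levC d ℓ a (D.lev x.1)) ((ℓ + 1) ^ D.lev x.1) x.1 y.1 * u y := by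
    intro y; rw [mlOpT_apply D rfl a x y, add_mul]
  simp only [Matrix.mulVec, dotProduct]
  rw [Finset.sum_congr rfl (fun y _ => happ y), Finset.sum_add_distrib]
  congr 1
  rw [Finset.mul_sum, Finset.sum_filter]
  refine Finset.sum_congr rfl fun y _ => ?_
  rw [avgK_lev_eq D]
  split_ifs <;> simp

/-- the level of a site is the level of its block. [cite: Balaban1984PropagatorsII, (2.45) p.231, dictionary] -/
theorem lev_eq_scale (x : ↥(boxDom (N0 ℓ Mh k P))) : D.lev x.1 = (blkOf D.toDomains x).1.1 :=
  B6Geom246MultiLevelBox.lev_eq_of_blkOf_eq D.toDomains rfl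

/-- `levC_j·#B(y) ≤ a_j·L^{−2j}` (the block has at most `L^{j(d+1)}` sites). [cite: Balaban1984PropagatorsII, (2.14) p.225, dictionary] -/
theorem levC_mul_card_le (ha : ∀ j, 0 ≤ a j) (s : ↥(bset D.toDomains)) :
    levC d ℓ a s.1.1 * (((Finset.univ.filter fun x : ↥(boxDom (N0 ℓ Mh k P)) => blkOf D.toDomains x = s).card : ℕ) : ℝ)
      ≤ a s.1.1 * ((((ℓ : ℝ) + 1) ^ s.1.1) ^ 2)⁻¹ := by
  have hc := card_blkOf_le D.toDomains s
  rw [W_eq] at hc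
  have hL : (0 : ℝ) < (((ℓ : ℝ) + 1) ^ s.1.1) ^ (d + 1) := by positivity
  unfold levC
  calc a s.1.1 * ((((ℓ : ℝ) + 1) ^ s.1.1) ^ 2)⁻¹ * ((((ℓ : ℝ) + 1) ^ s.1.1) ^ (d + 1))⁻¹
        * (((Finset.univ.filter fun x : ↥(boxDom (N0 ℓ Mh k P)) => blkOf D.toDomains x = s).card : ℕ) : ℝ)
      ≤ a s.1.1 * ((((ℓ : ℝ) + 1) ^ s.1.1) ^ 2)⁻¹ * ((((ℓ : ℝ) + 1) ^ s.1.1) ^ (d + 1))⁻¹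
        * (((ℓ : ℝ) + 1) ^ s.1.1) ^ (d + 1) :=
        mul_le_mul_of_nonneg_left hc (by have := ha s.1.1; positivity)
    _ = a s.1.1 * ((((ℓ : ℝ) + 1) ^ s.1.1) ^ 2)⁻¹ := by field_simp

/-- **LOCALISATION**: a weight supported over the blocks of `𝒩` and bounded by `Wc` localises a sum of nonnegative terms.
[cite: Balaban1985BackgroundPropagators, (3.46) p.398 («supp h ⊂ Δ̃(y)»), bookkeeping] -/
theorem sum_weight_le (w F : ↥(boxDom (N0 ℓ Mh k P)) → ℝ) (𝒩 : Finset ↥(bset D.toDomains)) {Wc : ℝ}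
    (hw : ∀ x, w x ≤ Wc) (hF : ∀ x, 0 ≤ F x) (h𝒩 : ∀ x, w x ≠ 0 → blkOf D.toDomains x ∈ 𝒩) :
    ∑ x, w x * F x ≤ Wc * ∑ s ∈ 𝒩, ∑ x ∈ Finset.univ.filter (fun x => blkOf D.toDomains x = s), F x := by
  classical
  rw [← Finset.sum_fiberwise Finset.univ (blkOf D.toDomains) (fun x => w x * F x), Finset.mul_sum]
  have hsplit : ∑ s, ∑ x ∈ Finset.univ.filter (fun x => blkOf D.toDomains x = s), w x * F x
      = ∑ s ∈ 𝒩, ∑ x ∈ Finset.univ.filter (fun x => blkOf D.toDomains x = s), w x * F x := by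
    rw [← Finset.sum_subset (Finset.subset_univ 𝒩)]
    intro s _ hs
    refine Finset.sum_eq_zero fun x hx => ?_
    have hx' : blkOf D.toDomains x = s := (Finset.mem_filter.1 hx).2
    by_cases hw0' : w x = 0
    · rw [hw0', zero_mul]
    · exact absurd (hx' ▸ h𝒩 x hw0') hs
  rw [hsplit]
  refine Finset.sum_le_sum fun s _ => ?_
  rw [Finset.mul_sum]
  exact Finset.sum_le_sum fun x _ => mul_le_mul_of_nonneg_right (hw x) (hF x)

/-- **THE FORM BOUND OF THE AVERAGING PART**: for `0 ≤ χ ≤ 1` supported over the blocks of `𝒩` and weights `a ≥ 0`,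
`|Σ_x χ(x)²u(x)·(Vu)(x)| ≤ Σ_{s∈𝒩} a_{j(s)}L^{−2j(s)}·Σ_{x∈B(s)} u(x)²`. [cite: Balaban1984PropagatorsII, (2.14) p.225; Balaban1985BackgroundPropagators, (3.46) p.398, dictionary] -/
theorem abs_form_V_le (ha : ∀ j, 0 ≤ a j) (χ u : ↥(boxDom (N0 ℓ Mh k P)) → ℝ) (𝒩 : Finset ↥(bset D.toDomains))
    (hχ0 : ∀ x, 0 ≤ χ x) (hχ1 : ∀ x, χ x ≤ 1) (h𝒩 : ∀ x, χ x ≠ 0 → blkOf D.toDomains x ∈ 𝒩) :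
    |∑ x, χ x ^ 2 * u x * (levC d ℓ a (D.lev x.1)
        * ∑ y ∈ Finset.univ.filter (fun y => blkOf D.toDomains y = blkOf D.toDomains x), u y)|
      ≤ ∑ s ∈ 𝒩, a s.1.1 * ((((ℓ : ℝ) + 1) ^ s.1.1) ^ 2)⁻¹
          * ∑ x ∈ Finset.univ.filter (fun x => blkOf D.toDomains x = s), u x ^ 2 := by
  classical
  -- group by blocks
  rw [← Finset.sum_fiberwise Finset.univ (blkOf D.toDomains)]
  have hblk : ∀ s : ↥(bset D.toDomains),
      ∑ x ∈ Finset.univ.filter (fun x => blkOf D.toDomains x = s), χ x ^ 2 * u x * (levC d ℓ a (D.lev x.1)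
        * ∑ y ∈ Finset.univ.filter (fun y => blkOf D.toDomains y = blkOf D.toDomains x), u y)
      = levC d ℓ a s.1.1 * (∑ y ∈ Finset.univ.filter (fun y => blkOf D.toDomains y = s), u y)
          * ∑ x ∈ Finset.univ.filter (fun x => blkOf D.toDomains x = s), χ x ^ 2 * u x := by
    intro s
    rw [Finset.mul_sum]
    refine Finset.sum_congr rfl fun x hx => ?_
    have hxs : blkOf D.toDomains x = s := (Finset.mem_filter.1 hx).2
    rw [lev_eq_scale D x, hxs]; ring
  simp only [hblk]
  -- blocks off `𝒩` contribute nothing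
  have hzero : ∀ s, s ∉ 𝒩 → ∑ x ∈ Finset.univ.filter (fun x => blkOf D.toDomains x = s), χ x ^ 2 * u x = 0 := by
    intro s hs
    refine Finset.sum_eq_zero fun x hx => ?_
    have hxs : blkOf D.toDomains x = s := (Finset.mem_filter.1 hx).2
    by_cases hχ : χ x = 0
    · rw [hχ]; ring
    · exact absurd (hxs ▸ h𝒩 x hχ) hs
  rw [← Finset.sum_subset (Finset.subset_univ 𝒩) (fun s _ hs => by rw [hzero s hs, mul_zero])]
  refine (Finset.abs_sum_le_sum_abs _ _).trans (Finset.sum_le_sum fun s _ => ?_)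
  set Bs := Finset.univ.filter (fun x : ↥(boxDom (N0 ℓ Mh k P)) => blkOf D.toDomains x = s) with hBs
  have hc0 : 0 ≤ levC d ℓ a s.1.1 := by unfold levC; have := ha s.1.1; positivity
  -- `|Σu|·|Σχ²u| ≤ (Σ|u|)² ≤ #B·Σu²`
  have h1 : |∑ y ∈ Bs, u y| ≤ ∑ y ∈ Bs, |u y| := Finset.abs_sum_le_sum_abs _ _
  have h2 : |∑ x ∈ Bs, χ x ^ 2 * u x| ≤ ∑ x ∈ Bs, |u x| := by
    refine (Finset.abs_sum_le_sum_abs _ _).trans (Finset.sum_le_sum fun x _ => ?_)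
    rw [abs_mul, abs_of_nonneg (sq_nonneg _)]
    have : χ x ^ 2 ≤ 1 := by
      have := hχ0 x; have := hχ1 x; nlinarith
    exact (mul_le_mul_of_nonneg_right this (abs_nonneg _)).trans_eq (one_mul _)
  have h3 : (∑ y ∈ Bs, |u y|) ^ 2 ≤ (Bs.card : ℝ) * ∑ y ∈ Bs, u y ^ 2 := by
    have := sq_sum_le_card_mul_sum_sq (s := Bs) (f := fun y => |u y|)
    simpa only [sq_abs] using this
  have hS : 0 ≤ ∑ y ∈ Bs, |u y| := Finset.sum_nonneg fun _ _ => abs_nonneg _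
  rw [abs_mul, abs_mul, abs_of_nonneg hc0, mul_assoc]
  calc levC d ℓ a s.1.1 * (|∑ y ∈ Bs, u y| * |∑ x ∈ Bs, χ x ^ 2 * u x|)
      ≤ levC d ℓ a s.1.1 * ((Bs.card : ℝ) * ∑ y ∈ Bs, u y ^ 2) := by
        refine mul_le_mul_of_nonneg_left ?_ hc0
        calc |∑ y ∈ Bs, u y| * |∑ x ∈ Bs, χ x ^ 2 * u x| ≤ (∑ y ∈ Bs, |u y|) * ∑ x ∈ Bs, |u x| :=
              mul_le_mul h1 h2 (abs_nonneg _) hS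
          _ = (∑ y ∈ Bs, |u y|) ^ 2 := by ring
          _ ≤ _ := h3
    _ = levC d ℓ a s.1.1 * (Bs.card : ℝ) * ∑ y ∈ Bs, u y ^ 2 := by ring
    _ ≤ a s.1.1 * ((((ℓ : ℝ) + 1) ^ s.1.1) ^ 2)⁻¹ * ∑ y ∈ Bs, u y ^ 2 :=
        mul_le_mul_of_nonneg_right (levC_mul_card_le D a ha s) (Finset.sum_nonneg fun _ _ => sq_nonneg _)

/-- **THE `L²` BOUND OF THE AVERAGING PART, localised by `χ`**: for `0 ≤ χ ≤ 1` supported over the blocks of `𝒩`,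
`Σ_x χ(x)²((Vu)(x))² ≤ Σ_{s∈𝒩} (a_{j(s)}L^{−2j(s)})²·Σ_{x∈B(s)} u(x)²`. [cite: Balaban1984PropagatorsII, (2.14) p.225; Balaban1985BackgroundPropagators, (3.46) p.398, dictionary] -/
theorem sum_sq_V_le (ha : ∀ j, 0 ≤ a j) (χ u : ↥(boxDom (N0 ℓ Mh k P)) → ℝ) (𝒩 : Finset ↥(bset D.toDomains))
    (hχ0 : ∀ x, 0 ≤ χ x) (hχ1 : ∀ x, χ x ≤ 1) (h𝒩 : ∀ x, χ x ≠ 0 → blkOf D.toDomains x ∈ 𝒩) :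
    ∑ x, χ x ^ 2 * (levC d ℓ a (D.lev x.1)
        * ∑ y ∈ Finset.univ.filter (fun y => blkOf D.toDomains y = blkOf D.toDomains x), u y) ^ 2
      ≤ ∑ s ∈ 𝒩, (a s.1.1 * ((((ℓ : ℝ) + 1) ^ s.1.1) ^ 2)⁻¹) ^ 2
          * ∑ x ∈ Finset.univ.filter (fun x => blkOf D.toDomains x = s), u x ^ 2 := by
  classical
  have hloc := sum_weight_le D (fun x => χ x ^ 2) (fun x => (levC d ℓ a (D.lev x.1)
      * ∑ y ∈ Finset.univ.filter (fun y => blkOf D.toDomains y = blkOf D.toDomains x), u y) ^ 2) 𝒩 (Wc := 1)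
    (fun x => by have := hχ0 x; have := hχ1 x; nlinarith) (fun x => sq_nonneg _)
    (fun x hx => h𝒩 x (fun h => hx (by rw [h]; ring)))
  rw [one_mul] at hloc
  refine hloc.trans (Finset.sum_le_sum fun s _ => ?_)
  set Bs := Finset.univ.filter (fun x : ↥(boxDom (N0 ℓ Mh k P)) => blkOf D.toDomains x = s) with hBs
  have hc0 : 0 ≤ levC d ℓ a s.1.1 := by unfold levC; have := ha s.1.1; positivity
  have hin : ∀ x ∈ Bs, (levC d ℓ a (D.lev x.1)
      * ∑ y ∈ Finset.univ.filter (fun y => blkOf D.toDomains y = blkOf D.toDomains x), u y) ^ 2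
      = (levC d ℓ a s.1.1 * ∑ y ∈ Bs, u y) ^ 2 := by
    intro x hx
    have hxs : blkOf D.toDomains x = s := (Finset.mem_filter.1 hx).2
    rw [lev_eq_scale D x, hxs]
  rw [Finset.sum_congr rfl hin, Finset.sum_const, nsmul_eq_mul]
  have h3 : (∑ y ∈ Bs, u y) ^ 2 ≤ (Bs.card : ℝ) * ∑ y ∈ Bs, u y ^ 2 := sq_sum_le_card_mul_sum_sq
  have hcl := levC_mul_card_le D a ha s
  have hQ : 0 ≤ ∑ y ∈ Bs, u y ^ 2 := Finset.sum_nonneg fun _ _ => sq_nonneg _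
  calc (Bs.card : ℝ) * (levC d ℓ a s.1.1 * ∑ y ∈ Bs, u y) ^ 2
      = levC d ℓ a s.1.1 ^ 2 * ((Bs.card : ℝ) * (∑ y ∈ Bs, u y) ^ 2) := by ring
    _ ≤ levC d ℓ a s.1.1 ^ 2 * ((Bs.card : ℝ) * ((Bs.card : ℝ) * ∑ y ∈ Bs, u y ^ 2)) :=
        mul_le_mul_of_nonneg_left (mul_le_mul_of_nonneg_left h3 (Nat.cast_nonneg _)) (sq_nonneg _)
    _ = (levC d ℓ a s.1.1 * (Bs.card : ℝ)) ^ 2 * ∑ y ∈ Bs, u y ^ 2 := by ring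
    _ ≤ (a s.1.1 * ((((ℓ : ℝ) + 1) ^ s.1.1) ^ 2)⁻¹) ^ 2 * ∑ y ∈ Bs, u y ^ 2 :=
        mul_le_mul_of_nonneg_right (pow_le_pow_left₀ (mul_nonneg hc0 (Nat.cast_nonneg _)) hcl 2) hQ

end Averaging

/-! ## §6 Duality: block bounds of a matrix and of its transpose -/

section Duality

/-- ★ **TRANSPOSITION OF A BLOCK BOUND**: if `Σ_{x∈B′}((Th)(x))² ≤ K·Σ_z h(z)²` for every `h` vanishing off `B`, then
`Σ_{x∈B}((Tᵀλ)(x))² ≤ K·Σ_z λ(z)²` for every `λ` vanishing off `B′` (`‖1_BTᵀ1_{B′}‖ = ‖1_{B′}T1_B‖`, by Cauchy–Schwarz on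
`⟨1_BTᵀλ, Tᵀλ⟩ = ⟨T(1_BTᵀλ), λ⟩`). [cite: Balaban1985BackgroundPropagators, (3.46) p.398 («we may always replace ∇_U by ∇*_U»: the member G′∇*∇* = (∇∇G′)ᵀ), dictionary] -/
theorem transpose_block_bound {X : Type} [Fintype X] [DecidableEq X] (T : Matrix X X ℝ) (B B' : Finset X) {K : ℝ}
    (hK : 0 ≤ K) (h : ∀ g : X → ℝ, (∀ z, z ∉ B → g z = 0) → ∑ x ∈ B', ((T *ᵥ g) x) ^ 2 ≤ K * ∑ z, g z ^ 2)
    (lam : X → ℝ) (hlam : ∀ z, z ∉ B' → lam z = 0) :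
    ∑ x ∈ B, ((Tᵀ *ᵥ lam) x) ^ 2 ≤ K * ∑ z, lam z ^ 2 := by
  set q : X → ℝ := fun x => if x ∈ B then (Tᵀ *ᵥ lam) x else 0 with hq
  have hqB : ∀ z, z ∉ B → q z = 0 := fun z hz => by simp only [hq, if_neg hz]
  set Q : ℝ := ∑ x ∈ B, ((Tᵀ *ᵥ lam) x) ^ 2 with hQdef
  have hQq : ∑ z, q z ^ 2 = Q := by
    rw [hQdef, ← Finset.sum_subset (Finset.subset_univ B) (fun z _ hz => by rw [hqB z hz]; ring)]
    exact Finset.sum_congr rfl fun z hz => by simp only [hq, if_pos hz]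
  -- `Q = ⟨q, Tᵀλ⟩ = ⟨Tq, λ⟩ = Σ_{B′} (Tq)·λ`
  have hQ1 : Q = ∑ x ∈ B', (T *ᵥ q) x * lam x := by
    have e1 : Q = q ⬝ᵥ (Tᵀ *ᵥ lam) := by
      unfold dotProduct
      rw [hQdef, ← Finset.sum_subset (Finset.subset_univ B) (fun z _ hz => by rw [hqB z hz, zero_mul])]
      exact Finset.sum_congr rfl fun z hz => by simp only [hq, if_pos hz]; ring
    rw [e1, Matrix.dotProduct_mulVec, Matrix.vecMul_transpose]
    unfold dotProduct
    rw [← Finset.sum_subset (Finset.subset_univ B') (fun z _ hz => by rw [hlam z hz, mul_zero])]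
  -- Cauchy–Schwarz and the hypothesis for `q`
  have hCS : Q ^ 2 ≤ (K * Q) * ∑ z, lam z ^ 2 := by
    rw [hQ1]
    refine (Finset.sum_mul_sq_le_sq_mul_sq B' (fun x => (T *ᵥ q) x) lam).trans ?_
    rw [← hQ1]
    have hB' : ∑ x ∈ B', lam x ^ 2 = ∑ z, lam z ^ 2 :=
      Finset.sum_subset (Finset.subset_univ B') (fun z _ hz => by rw [hlam z hz]; ring)
    rw [hB']
    refine mul_le_mul_of_nonneg_right ?_ (Finset.sum_nonneg fun _ _ => sq_nonneg _)
    exact (h q hqB).trans_eq (by rw [hQq])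
  have hQ0 : 0 ≤ Q := Finset.sum_nonneg fun _ _ => sq_nonneg _
  have hΛ : 0 ≤ ∑ z, lam z ^ 2 := Finset.sum_nonneg fun _ _ => sq_nonneg _
  by_contra hlt
  rw [not_le] at hlt
  have hQpos : 0 < Q := lt_of_le_of_lt (mul_nonneg hK hΛ) hlt
  nlinarith [mul_lt_mul_of_pos_right hlt hQpos]

end Duality

end Literature.MathematicalPhysics.QuantumFieldTheory.Balaban1983to89.B9Ineq346SecondOrderTorusCore

end
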